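import Mathlib
import Summits.NavierStokesRegularity.OSWSelfSimilar.SheetMomentIdentity
import Summits.NavierStokesRegularity.OSWSelfSimilar.SheetHalfLineMomentNull
import Summits.NavierStokesRegularity.OSWSelfSimilar.SheetHalfLineVelocitySign
import Summits.NavierStokesRegularity.OSWSelfSimilar.SheetNSLineViscousCLMUnique
import HarnessLib

/-!
# Viscous gCLM MODEL on `ℝ` (constant viscosity = the NS-type line, DYNAMIC): the FIRST-MOMENT LAW
# `d/dt ∫₀^∞ x ω(t,x) dx = a ∫₀^∞ u ω dx`, and its sign in Chen's class 3 — focusing for `a > 0`,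
# a conservation law at the CLM point `a = 0`, DEFOCUSING for `a < 0`

HONEST FRAMING (cell ns-blowup GROUP B «PROFILE SEARCH», zone Z3 = the 1-D viscous gCLM/OSW MODEL; human rulings D-0035/D-0074):
**1-D MODEL; kernel-checked calculus for CLASSICAL DECAYING solutions of the model PDE; not Euler, not Navier–Stokes;
«violates: none — MODEL».** Nothing in this file is a statement about Navier–Stokes.

OBJECT. Classical decaying solutions on `(0,T) × ℝ` of the generalised Constantin–Lax–Majda / Okamoto–Sakajo–Wunsch model with
constant viscosity (the PDE whose self-similar profiles populate the NS-type line `c_l = c_ω/2` of the cell's sheet),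
  `∂ₜω + a u ∂ₓω = ω·Hω + ν ∂ₓₓω`,   `∂ₓu = Hω` (genuine `hilbertTransform`),
given as functions `ω, ωx, ωxx, u : ℝ → ℝ → ℝ` of `(t, x)` with `C²` odd slices, the weighted envelopes
`|ω|, |xω|, |xωx|, |xωxx| ≤ C/(1+x²)`, `|ωx|, |Hω|, |u| ≤ C`, and the PDE as a pointwise `t`-derivative. The scale-invariant
(dimensionless under `ω ↦ λ²ω(λ²t, λx)`) half-line FIRST MOMENT is `M(t) = ∫₀^∞ x ω(t,x) dx`.

WHAT IS KERNEL-CHECKED HERE.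
* `pde_slice_is_F1` — bookkeeping: a PDE slice is the sheet residual `F₁(0, 0, a, 1, ν, Hω, u, ω, ωx, ωxx, P) ≡ 0` with forcing
  `P = −∂ₜω`, so the STEADY first-moment identity (M) of `SheetMomentIdentity` applies verbatim to the dynamics.
* `firstMoment_hasDerivAt` — **THE FIRST-MOMENT LAW: `M′(t) = a ∫₀^∞ u(t,x) ω(t,x) dx` on `(0,T)`** (dominated differentiation
  under the integral; then (M) with `P = −∂ₜω`: `∫₀^∞ x ∂ₜω = a∫₀^∞ uω + (1+a)∫₀^∞ x(Hω)ω`, and the MOMENT NULL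
  `∫₀^∞ x(Hω)ω = 0` of `SheetHalfLineMomentNull`). In particular **at the CLM point `a = 0` the first moment is CONSERVED by the
  viscous CLM on `ℝ` in the odd class** (`firstMoment_const_of_a_eq_zero`; e.g. Schochet's blow-up solution of
  `SheetNSLineSchochetTwoPole` keeps `∫₀^∞ xω = −12π(k+1)ν` all the way to the blow-up time — pen: `∫₀^∞ x²dx/((x²+p²)(x²+q²)) = π/(2(p+q))`;
  the corner `−24νxy/(x²+y²)²` alone has `∫₀^∞ xω = −6πν` for every depth `y`). `M` is scale-invariant, so an EXACTLY self-similar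
  NS-type-line solution has constant `M = (ν/ε)∫₀^∞ξΩ`; for `a ≠ 0` this is compatible with `M′ = a∫uω ≠ 0` only if `∫ξΩ` diverges —
  the dynamic reading of the `ξ⁻²` tail law `c_l·A = a∫₀^∞𝒰Ω` of `SheetNSLineMomentSignLaw` (and of `A = 0` at `a = 0`).
* `firstMoment_monotoneOn_of_a_nonpos` / `firstMoment_antitoneOn_of_a_nonneg` — **SIGN IN CHEN'S CLASS 3** (`ω(t,·)` odd,
  `≤ 0` on `(0,∞)`): the velocity is OUTWARD (`u ≥ 0` on `(0,∞)`, `SheetHalfLineVelocitySign.velocity_nonneg`), so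
  `∫₀^∞ uω ≤ 0` and `sgn M′ = −sgn a`: for `a ≤ 0` the (nonpositive) moment `M` is NONDECREASING — `|M(t)|` can only SHRINK
  (DEFOCUSING; and `∫_{t₁}^{t₂} (−∫₀^∞uω) dt ≤ (M(t₂) − M(t₁))/|a|` is an a-priori spacetime bound) — while for `a ≥ 0` it is
  NONINCREASING (`|M|` grows: FOCUSING). This is the DYNAMIC companion of the steady divide of CENSUS-Z3 row Z3-E12⁻ clause (i′)
  (`SheetNSLineMomentSignLaw.nsTypeLine_ESigned_empty_of_a_neg`: no E-signed NS-type-line profile for `a < 0`; tail `A = 0` at `a = 0`;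
  `A < 0` for `a > 0`): the same pairing `a∫₀^∞uω` that fixes the profile's `ξ⁻²` tail drives the moment of every classical solution.
NOT PROVED HERE: existence, blow-up or global regularity of anything (the «arrest» word of clause (i′) stays class (D) numerics);
solutions outside the class (non-decaying, `xω ∉ L¹`, e.g. exactly self-similar E½-type solutions whose moment is infinite); NS.
bears_on: LADDER-NS N5 / zone Z3 clause (i′) (CENSUS-Z3 v2.9 §0) → N1 linear core; SELFSIM-NOGO M7/M8 MODEL side.
-/

noncomputable section
open Set Filter Topology MeasureTheory

namespace Summit.NavierStokesRegularity.OSWSelfSimilar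
namespace SheetHalfLine
open HouLuoOriginLaws (F1)
open Literature.Analysis.Fourier SheetNSLineViscousCLMUnique

/-- `R/(1+R²) → 0` at `+∞`. [folklore] -/
private theorem ml_tendsto_div_one_add_sq : Tendsto (fun x : ℝ => x / (1 + x ^ 2)) atTop (𝓝 0) := by
  have h1 : Tendsto (fun x : ℝ => x⁻¹) atTop (𝓝 0) := tendsto_inv_atTop_zero
  have e : ∀ᶠ x : ℝ in atTop, x / (1 + x ^ 2) ≤ x⁻¹ := by
    filter_upwards [eventually_gt_atTop (0:ℝ)] with x hx
    rw [div_le_iff₀ (by positivity), inv_mul_eq_div, le_div_iff₀ hx]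
    nlinarith
  have e0 : ∀ᶠ x : ℝ in atTop, 0 ≤ x / (1 + x ^ 2) := by
    filter_upwards [eventually_ge_atTop (0:ℝ)] with x hx
    positivity
  exact tendsto_of_tendsto_of_tendsto_of_le_of_le' tendsto_const_nhds h1 e0 e

section MomentLaw

variable {a ν T C : ℝ} {ω ωx ωxx u : ℝ → ℝ → ℝ}

/-- Bookkeeping: a slice of the PDE `∂ₜω = −a u ωₓ + ω·Hω + ν ωₓₓ` is the sheet residual
`F₁(c_ω = 0, c_l = 0, a, b = 1, ε = ν)` with forcing `P = −∂ₜω`, identically in `ξ`. [new here — MODEL bookkeeping] -/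
theorem pde_slice_is_F1 (H U Om dOm ddOm Omt : ℝ → ℝ)
    (hpde : ∀ ξ, Omt ξ = -(a * U ξ * dOm ξ) + Om ξ * H ξ + ν * ddOm ξ) (ξ : ℝ) :
    F1 0 0 a 1 ν H U Om dOm ddOm (fun x => -Omt x) ξ = 0 := by
  unfold HouLuoOriginLaws.F1
  simp only [hpde]
  ring

/-- **THE FIRST-MOMENT LAW of the viscous gCLM on `ℝ`.** For a classical decaying solution on `(0,T)` (odd `C²` slices, weighted
envelopes `|ω|, |xω|, |xωₓ|, |xωₓₓ| ≤ C/(1+x²)`, `|ωₓ|, |Hω|, |u| ≤ C`, `∂ₓu = Hω` with the genuine Hilbert transform, the PDE as a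
pointwise `t`-derivative), the half-line first moment `M(t) = ∫₀^∞ x ω(t,x) dx` is differentiable on `(0,T)` with
**`M′(t) = a ∫₀^∞ u(t,x) ω(t,x) dx`**. [new here — MODEL] -/
theorem firstMoment_hasDerivAt (hC : 0 ≤ C)
    (hx : ∀ t ∈ Ioo 0 T, ∀ x, HasDerivAt (ω t) (ωx t x) x)
    (hxx : ∀ t ∈ Ioo 0 T, ∀ x, HasDerivAt (ωx t) (ωxx t x) x)
    (hodd : ∀ t ∈ Ioo 0 T, ∀ x, ω t (-x) = -ω t x)
    (hu : ∀ t ∈ Ioo 0 T, ∀ x, HasDerivAt (u t) (hilbertTransform (ω t) x) x)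
    (hb : ∀ t ∈ Ioo 0 T, ∀ x, |ω t x| ≤ C / (1 + x ^ 2) ∧ |x * ω t x| ≤ C / (1 + x ^ 2) ∧ |ωx t x| ≤ C ∧
      |x * ωx t x| ≤ C / (1 + x ^ 2) ∧ |x * ωxx t x| ≤ C / (1 + x ^ 2) ∧ |hilbertTransform (ω t) x| ≤ C ∧ |u t x| ≤ C)
    (ht : ∀ t ∈ Ioo 0 T, ∀ x,
      HasDerivAt (fun τ => ω τ x) (-(a * u t x * ωx t x) + ω t x * hilbertTransform (ω t) x + ν * ωxx t x) t) :
    ∀ t ∈ Ioo 0 T, HasDerivAt (fun τ => ∫ x in Ioi (0:ℝ), x * ω τ x) (a * ∫ x in Ioi (0:ℝ), u t x * ω t x) t := by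
  intro t htI
  -- notation for the time derivative slice
  set ωt : ℝ → ℝ → ℝ := fun τ x => -(a * u τ x * ωx τ x) + ω τ x * hilbertTransform (ω τ) x + ν * ωxx τ x with hωt
  -- continuity / measurability of slices
  have hωc : ∀ τ ∈ Ioo 0 T, Continuous (ω τ) := fun τ hτ => continuous_iff_continuousAt.2 fun x => (hx τ hτ x).continuousAt
  have hωxc : ∀ τ ∈ Ioo 0 T, Continuous (ωx τ) :=
    fun τ hτ => continuous_iff_continuousAt.2 fun x => (hxx τ hτ x).continuousAt
  have huc : ∀ τ ∈ Ioo 0 T, Continuous (u τ) := fun τ hτ => continuous_iff_continuousAt.2 fun x => (hu τ hτ x).continuousAt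
  have hHm : ∀ τ ∈ Ioo 0 T, AEStronglyMeasurable (hilbertTransform (ω τ)) :=
    fun τ hτ => (riesz_of_env (hx τ hτ) (hxx τ hτ) (fun x => (hb τ hτ x).1)).1.aestronglyMeasurable
  have hωtm : ∀ τ ∈ Ioo 0 T, AEStronglyMeasurable (fun x => x * ωt τ x) := by
    intro τ hτ
    have m1 : AEStronglyMeasurable (fun x => -(a * u τ x * ωx τ x)) (volume : Measure ℝ) :=
      (((huc τ hτ).const_mul a).mul (hωxc τ hτ)).neg.aestronglyMeasurable
    have m2 : AEStronglyMeasurable (fun x => ω τ x * hilbertTransform (ω τ) x) (volume : Measure ℝ) :=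
      (hωc τ hτ).aestronglyMeasurable.mul (hHm τ hτ)
    have m3 : AEStronglyMeasurable (fun x => ν * ωxx τ x) (volume : Measure ℝ) :=
      aestronglyMeasurable_const.mul (aestronglyMeasurable_of_hasDerivAt (hxx τ hτ))
    exact continuous_id.aestronglyMeasurable.mul ((m1.add m2).add m3)
  -- the t-uniform weighted bound |x ωt| ≤ K/(1+x²)
  set K : ℝ := |a| * C * C + C * C + |ν| * C with hK
  have hbound : ∀ τ ∈ Ioo 0 T, ∀ x, |x * ωt τ x| ≤ K / (1 + x ^ 2) := by
    intro τ hτ x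
    obtain ⟨_, h2, _, h4, h5, h6, h7⟩ := hb τ hτ x
    have hpos : (0:ℝ) < 1 + x ^ 2 := by positivity
    have e : x * ωt τ x = -(a * (u τ x * (x * ωx τ x))) + (x * ω τ x) * hilbertTransform (ω τ) x + ν * (x * ωxx τ x) := by
      simp only [hωt]
      ring
    rw [e]
    have b1 : |-(a * (u τ x * (x * ωx τ x)))| ≤ |a| * C * C / (1 + x ^ 2) := by
      rw [abs_neg, abs_mul, abs_mul]
      have := mul_le_mul h7 h4 (abs_nonneg _) hC
      calc |a| * (|u τ x| * |x * ωx τ x|) ≤ |a| * (C * (C / (1 + x ^ 2))) :=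
            mul_le_mul_of_nonneg_left this (abs_nonneg a)
        _ = |a| * C * C / (1 + x ^ 2) := by ring
    have b2 : |x * ω τ x * hilbertTransform (ω τ) x| ≤ C * C / (1 + x ^ 2) := by
      rw [abs_mul]
      calc |x * ω τ x| * |hilbertTransform (ω τ) x| ≤ C / (1 + x ^ 2) * C :=
            mul_le_mul h2 h6 (abs_nonneg _) (by positivity)
        _ = C * C / (1 + x ^ 2) := by ring
    have b3 : |ν * (x * ωxx τ x)| ≤ |ν| * C / (1 + x ^ 2) := by
      rw [abs_mul, mul_div_assoc]
      exact mul_le_mul_of_nonneg_left h5 (abs_nonneg ν)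
    have tri : |-(a * (u τ x * (x * ωx τ x))) + x * ω τ x * hilbertTransform (ω τ) x + ν * (x * ωxx τ x)|
        ≤ |-(a * (u τ x * (x * ωx τ x)))| + |x * ω τ x * hilbertTransform (ω τ) x| + |ν * (x * ωxx τ x)| := by
      have t1 := abs_add_le (-(a * (u τ x * (x * ωx τ x))) + x * ω τ x * hilbertTransform (ω τ) x) (ν * (x * ωxx τ x))
      have t2 := abs_add_le (-(a * (u τ x * (x * ωx τ x)))) (x * ω τ x * hilbertTransform (ω τ) x)
      linarith
    calc |-(a * (u τ x * (x * ωx τ x))) + x * ω τ x * hilbertTransform (ω τ) x + ν * (x * ωxx τ x)|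
        ≤ |-(a * (u τ x * (x * ωx τ x)))| + |x * ω τ x * hilbertTransform (ω τ) x| + |ν * (x * ωxx τ x)| := tri
      _ ≤ |a| * C * C / (1 + x ^ 2) + C * C / (1 + x ^ 2) + |ν| * C / (1 + x ^ 2) := add_le_add (add_le_add b1 b2) b3
      _ = K / (1 + x ^ 2) := by simp only [hK]; ring
  -- STEP 1: dominated differentiation under ∫₀^∞
  have hs : Ioo 0 T ∈ 𝓝 t := Ioo_mem_nhds htI.1 htI.2
  have hMint : Integrable (fun x => x * ω t x) (volume.restrict (Ioi (0:ℝ))) :=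
    (integrable_of_le_env (continuous_id.mul (hωc t htI)) (fun x => (hb t htI x).2.1)).integrableOn
  have hD := hasDerivAt_integral_of_dominated_loc_of_deriv_le (μ := volume.restrict (Ioi (0:ℝ)))
    (F := fun τ x => x * ω τ x) (F' := fun τ x => x * ωt τ x) (bound := fun x => K / (1 + x ^ 2)) hs
    (by
      filter_upwards [hs] with τ hτ
      exact (continuous_id.mul (hωc τ hτ)).aestronglyMeasurable)
    hMint ((hωtm t htI).restrict)
    (ae_of_all _ fun x τ hτ => by rw [Real.norm_eq_abs]; exact hbound τ hτ x)
    ((integrable_of_le_env (f := fun x : ℝ => K / (1 + x ^ 2)) (K := |K|)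
        (continuous_const.div (by fun_prop) fun x => by positivity) (fun x => by
        rw [abs_div, abs_of_pos (by positivity : (0:ℝ) < 1 + x ^ 2)])).integrableOn)
    (ae_of_all _ fun x τ hτ => (ht τ hτ x).const_mul x)
  -- STEP 2: the spatial identity ∫₀^∞ x ωt = a ∫₀^∞ uω, by (M) with P = −ωt and the moment null
  have hω0 : ω t 0 = 0 := by
    have h := hodd t htI 0
    simp only [neg_zero] at h
    linarith
  have hF : ∀ ξ ∈ Ioi (0:ℝ), F1 0 0 a 1 ν (hilbertTransform (ω t)) (u t) (ω t) (ωx t) (ωxx t) (fun x => -ωt t x) ξ = 0 :=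
    fun ξ _ => pde_slice_is_F1 (a := a) (ν := ν) _ _ _ _ _ (ωt t) (fun ξ => by simp only [hωt]) ξ
  have le_C : ∀ {y : ℝ} {x : ℝ}, |y| ≤ C / (1 + x ^ 2) → |y| ≤ C := fun {y x} hy =>
    hy.trans (div_le_self hC (by nlinarith [sq_nonneg x]))
  -- integrability on (0,∞) of ξω, uω, ξ(Hω)ω, ξ·(−ωt)
  have iξOm : IntegrableOn (fun ξ => ξ * ω t ξ) (Ioi 0) := hMint
  have iUOm : IntegrableOn (fun ξ => u t ξ * ω t ξ) (Ioi 0) := by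
    refine (integrable_of_le_env (f := fun x => u t x * ω t x) ((huc t htI).mul (hωc t htI)) (K := C * C)
      fun x => ?_).integrableOn
    rw [abs_mul]
    calc |u t x| * |ω t x| ≤ C * (C / (1 + x ^ 2)) := mul_le_mul (hb t htI x).2.2.2.2.2.2 (hb t htI x).1 (abs_nonneg _) hC
      _ = C * C / (1 + x ^ 2) := by ring
  have iH : IntegrableOn (fun ξ => ξ * (hilbertTransform (ω t) ξ * ω t ξ)) (Ioi 0) := by
    refine (integrable_of_le_env' (f := fun ξ => ξ * (hilbertTransform (ω t) ξ * ω t ξ)) (K := C * C) ?_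
      fun x => ?_).integrableOn
    · exact continuous_id.aestronglyMeasurable.mul ((hHm t htI).mul (hωc t htI).aestronglyMeasurable)
    · rw [show x * (hilbertTransform (ω t) x * ω t x) = (x * ω t x) * hilbertTransform (ω t) x by ring, abs_mul]
      calc |x * ω t x| * |hilbertTransform (ω t) x| ≤ C / (1 + x ^ 2) * C :=
            mul_le_mul (hb t htI x).2.1 (hb t htI x).2.2.2.2.2.1 (abs_nonneg _) (by positivity)
        _ = C * C / (1 + x ^ 2) := by ring
  have iP : IntegrableOn (fun ξ => ξ * (fun x => -ωt t x) ξ) (Ioi 0) := by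
    have h := hD.1
    have h' : IntegrableOn (fun ξ => -(ξ * ωt t ξ)) (Ioi 0) := h.neg
    refine h'.congr_fun (fun ξ _ => ?_) measurableSet_Ioi
    ring
  -- decay at +∞ of ξ²ω, ξ u ω, ξ ωx, ω
  have hinv : Tendsto (fun R : ℝ => C / (1 + R ^ 2)) atTop (𝓝 0) :=
    tendsto_const_nhds.div_atTop (tendsto_atTop_add_const_left _ _ (tendsto_pow_atTop two_ne_zero))
  have hCR : Tendsto (fun R : ℝ => C * R / (1 + R ^ 2)) atTop (𝓝 0) := by
    have h := ml_tendsto_div_one_add_sq.const_mul C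
    rw [mul_zero] at h
    refine h.congr' (Eventually.of_forall fun R => ?_)
    ring
  have hsq : Tendsto (fun R => R ^ 2 * ω t R) atTop (𝓝 0) := by
    refine squeeze_zero_norm' ?_ hCR
    filter_upwards [eventually_ge_atTop (0:ℝ)] with R hR
    rw [Real.norm_eq_abs, show R ^ 2 * ω t R = R * (R * ω t R) by ring, abs_mul, abs_of_nonneg hR, mul_comm C R, mul_div_assoc]
    exact mul_le_mul_of_nonneg_left (hb t htI R).2.1 hR
  have hUOm : Tendsto (fun R => R * u t R * ω t R) atTop (𝓝 0) := by
    have h0 : Tendsto (fun R : ℝ => C * (C / (1 + R ^ 2))) atTop (𝓝 (C * 0)) := hinv.const_mul C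
    rw [mul_zero] at h0
    refine squeeze_zero_norm (fun R => ?_) h0
    rw [Real.norm_eq_abs, show R * u t R * ω t R = u t R * (R * ω t R) by ring, abs_mul]
    exact mul_le_mul (hb t htI R).2.2.2.2.2.2 (hb t htI R).2.1 (abs_nonneg _) hC
  have hdOm1 : Tendsto (fun R => R * ωx t R) atTop (𝓝 0) :=
    squeeze_zero_norm (fun R => by rw [Real.norm_eq_abs]; exact (hb t htI R).2.2.2.1) hinv
  have hOmInf : Tendsto (ω t) atTop (𝓝 0) :=
    squeeze_zero_norm (fun R => by rw [Real.norm_eq_abs]; exact (hb t htI R).1) hinv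
  -- the moment null for the slice
  have hmom : ∫ ξ in Ioi (0:ℝ), ξ * (hilbertTransform (ω t) ξ * ω t ξ) = 0 := by
    have hi := integrable_of_le_env (hωc t htI) (fun x => (hb t htI x).1)
    have h2 := memLp_two_of_le_env (hωc t htI) (fun x => (hb t htI x).1)
    have hx2 : MemLp (fun y => y * ω t y) 2 := memLp_two_of_le_env (continuous_id.mul (hωc t htI)) (fun x => (hb t htI x).2.1)
    exact integral_Ioi_id_mul_hilbertTransform_mul_eq_zero (hodd t htI) hi h2 hx2
      (symm_integrable_of_env (hx t htI) (hxx t htI) (fun x => (hb t htI x).1))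
  have hM := moment_identity 0 0 a 1 ν (hilbertTransform (ω t)) (u t) (ω t) (ωx t) (ωxx t) (fun x => -ωt t x)
    (hu t htI) (hx t htI) (hxx t htI) hω0 hF iξOm iUOm iH iP hsq hUOm hdOm1 hOmInf
  have hkey : ∫ x in Ioi (0:ℝ), x * ωt t x = a * ∫ x in Ioi (0:ℝ), u t x * ω t x := by
    have e : ∫ ξ in Ioi (0:ℝ), ξ * (fun x => -ωt t x) ξ = -∫ ξ in Ioi (0:ℝ), ξ * ωt t ξ := by
      rw [← integral_neg]
      refine setIntegral_congr_fun measurableSet_Ioi fun ξ _ => ?_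
      ring
    rw [e, hmom] at hM
    linarith
  -- conclude
  have h := hD.2
  rw [hkey] at h
  exact h

/-- **CLASS-3 SIGN OF THE FIRST-MOMENT LAW, `a ≤ 0`: DEFOCUSING.** In the setting of `firstMoment_hasDerivAt` with `u(t,0) = 0` and
`ω(t,·) ≤ 0` on `(0,∞)` for every `t ∈ (0,T)` (Chen's class 3, preserved by the flow in print), the velocity is outward
(`u ≥ 0` on `(0,∞)`), so `∫₀^∞ uω ≤ 0` and for `a ≤ 0` the (nonpositive) first moment `M(t) = ∫₀^∞ xω` is NONDECREASING on
`(0,T)`: `|M|` can only shrink. At `a = 0` combine with `firstMoment_antitoneOn_of_a_nonneg`: `M` is CONSERVED. [new here — MODEL] -/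
theorem firstMoment_monotoneOn_of_a_nonpos (hC : 0 ≤ C) (ha : a ≤ 0)
    (hx : ∀ t ∈ Ioo 0 T, ∀ x, HasDerivAt (ω t) (ωx t x) x)
    (hxx : ∀ t ∈ Ioo 0 T, ∀ x, HasDerivAt (ωx t) (ωxx t x) x)
    (hodd : ∀ t ∈ Ioo 0 T, ∀ x, ω t (-x) = -ω t x)
    (hu : ∀ t ∈ Ioo 0 T, ∀ x, HasDerivAt (u t) (hilbertTransform (ω t) x) x) (hu0 : ∀ t ∈ Ioo 0 T, u t 0 = 0)
    (hb : ∀ t ∈ Ioo 0 T, ∀ x, |ω t x| ≤ C / (1 + x ^ 2) ∧ |x * ω t x| ≤ C / (1 + x ^ 2) ∧ |ωx t x| ≤ C ∧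
      |x * ωx t x| ≤ C / (1 + x ^ 2) ∧ |x * ωxx t x| ≤ C / (1 + x ^ 2) ∧ |hilbertTransform (ω t) x| ≤ C ∧ |u t x| ≤ C)
    (ht : ∀ t ∈ Ioo 0 T, ∀ x,
      HasDerivAt (fun τ => ω τ x) (-(a * u t x * ωx t x) + ω t x * hilbertTransform (ω t) x + ν * ωxx t x) t)
    (hsign : ∀ t ∈ Ioo 0 T, ∀ x ∈ Ioi (0:ℝ), ω t x ≤ 0) :
    MonotoneOn (fun τ => ∫ x in Ioi (0:ℝ), x * ω τ x) (Ioo 0 T) := by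
  have hD := firstMoment_hasDerivAt hC hx hxx hodd hu hb ht
  -- the pairing is ≤ 0 at every time: outward velocity
  have hJ : ∀ t ∈ Ioo 0 T, ∫ x in Ioi (0:ℝ), u t x * ω t x ≤ 0 := by
    intro t htI
    have hωxc : Continuous (ωx t) := continuous_iff_continuousAt.2 fun x => (hxx t htI x).continuousAt
    have hUnn : ∀ ξ ∈ Ioi (0:ℝ), 0 ≤ u t ξ := fun ξ hξ =>
      velocity_nonneg (hodd t htI) (hx t htI) hωxc (fun y => (hb t htI y).2.2.1) (fun y => (hb t htI y).1) (hu t htI)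
        (hu0 t htI) (hsign t htI) (le_of_lt hξ)
    exact setIntegral_nonpos measurableSet_Ioi fun ξ hξ => mul_nonpos_of_nonneg_of_nonpos (hUnn ξ hξ) (hsign t htI ξ hξ)
  refine monotoneOn_of_deriv_nonneg (convex_Ioo 0 T) ?_ ?_ ?_
  · exact fun t ht => (hD t ht).continuousAt.continuousWithinAt
  · rw [interior_Ioo]
    exact fun t ht => (hD t ht).differentiableAt.differentiableWithinAt
  · rw [interior_Ioo]
    intro t ht
    rw [(hD t ht).deriv]
    exact mul_nonneg_of_nonpos_of_nonpos ha (hJ t ht)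

/-- **CLASS-3 SIGN OF THE FIRST-MOMENT LAW, `a ≥ 0`: FOCUSING.** Same setting, `a ≥ 0`: `M` is NONINCREASING on `(0,T)` (the
nonpositive moment grows in size). [new here — MODEL] -/
theorem firstMoment_antitoneOn_of_a_nonneg (hC : 0 ≤ C) (ha : 0 ≤ a)
    (hx : ∀ t ∈ Ioo 0 T, ∀ x, HasDerivAt (ω t) (ωx t x) x)
    (hxx : ∀ t ∈ Ioo 0 T, ∀ x, HasDerivAt (ωx t) (ωxx t x) x)
    (hodd : ∀ t ∈ Ioo 0 T, ∀ x, ω t (-x) = -ω t x)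
    (hu : ∀ t ∈ Ioo 0 T, ∀ x, HasDerivAt (u t) (hilbertTransform (ω t) x) x) (hu0 : ∀ t ∈ Ioo 0 T, u t 0 = 0)
    (hb : ∀ t ∈ Ioo 0 T, ∀ x, |ω t x| ≤ C / (1 + x ^ 2) ∧ |x * ω t x| ≤ C / (1 + x ^ 2) ∧ |ωx t x| ≤ C ∧
      |x * ωx t x| ≤ C / (1 + x ^ 2) ∧ |x * ωxx t x| ≤ C / (1 + x ^ 2) ∧ |hilbertTransform (ω t) x| ≤ C ∧ |u t x| ≤ C)
    (ht : ∀ t ∈ Ioo 0 T, ∀ x,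
      HasDerivAt (fun τ => ω τ x) (-(a * u t x * ωx t x) + ω t x * hilbertTransform (ω t) x + ν * ωxx t x) t)
    (hsign : ∀ t ∈ Ioo 0 T, ∀ x ∈ Ioi (0:ℝ), ω t x ≤ 0) :
    AntitoneOn (fun τ => ∫ x in Ioi (0:ℝ), x * ω τ x) (Ioo 0 T) := by
  have hD := firstMoment_hasDerivAt hC hx hxx hodd hu hb ht
  have hJ : ∀ t ∈ Ioo 0 T, ∫ x in Ioi (0:ℝ), u t x * ω t x ≤ 0 := by
    intro t htI
    have hωxc : Continuous (ωx t) := continuous_iff_continuousAt.2 fun x => (hxx t htI x).continuousAt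
    have hUnn : ∀ ξ ∈ Ioi (0:ℝ), 0 ≤ u t ξ := fun ξ hξ =>
      velocity_nonneg (hodd t htI) (hx t htI) hωxc (fun y => (hb t htI y).2.2.1) (fun y => (hb t htI y).1) (hu t htI)
        (hu0 t htI) (hsign t htI) (le_of_lt hξ)
    exact setIntegral_nonpos measurableSet_Ioi fun ξ hξ => mul_nonpos_of_nonneg_of_nonpos (hUnn ξ hξ) (hsign t htI ξ hξ)
  refine antitoneOn_of_deriv_nonpos (convex_Ioo 0 T) ?_ ?_ ?_
  · exact fun t ht => (hD t ht).continuousAt.continuousWithinAt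
  · rw [interior_Ioo]
    exact fun t ht => (hD t ht).differentiableAt.differentiableWithinAt
  · rw [interior_Ioo]
    intro t ht
    rw [(hD t ht).deriv]
    exact mul_nonpos_of_nonneg_of_nonpos ha (hJ t ht)

/-- **At the CLM point `a = 0` the first moment is CONSERVED** for every classical decaying solution (any sign structure: the
derivative `a∫₀^∞uω` vanishes identically). [new here — MODEL] -/
theorem firstMoment_const_of_a_eq_zero (hC : 0 ≤ C)
    (hx : ∀ t ∈ Ioo 0 T, ∀ x, HasDerivAt (ω t) (ωx t x) x)
    (hxx : ∀ t ∈ Ioo 0 T, ∀ x, HasDerivAt (ωx t) (ωxx t x) x)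
    (hodd : ∀ t ∈ Ioo 0 T, ∀ x, ω t (-x) = -ω t x)
    (hu : ∀ t ∈ Ioo 0 T, ∀ x, HasDerivAt (u t) (hilbertTransform (ω t) x) x)
    (hb : ∀ t ∈ Ioo 0 T, ∀ x, |ω t x| ≤ C / (1 + x ^ 2) ∧ |x * ω t x| ≤ C / (1 + x ^ 2) ∧ |ωx t x| ≤ C ∧
      |x * ωx t x| ≤ C / (1 + x ^ 2) ∧ |x * ωxx t x| ≤ C / (1 + x ^ 2) ∧ |hilbertTransform (ω t) x| ≤ C ∧ |u t x| ≤ C)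
    (ht : ∀ t ∈ Ioo 0 T, ∀ x,
      HasDerivAt (fun τ => ω τ x) (-(0 * u t x * ωx t x) + ω t x * hilbertTransform (ω t) x + ν * ωxx t x) t) :
    ∀ s ∈ Ioo 0 T, ∀ t ∈ Ioo 0 T, ∫ x in Ioi (0:ℝ), x * ω s x = ∫ x in Ioi (0:ℝ), x * ω t x := by
  have hD := firstMoment_hasDerivAt (a := 0) hC hx hxx hodd hu hb ht
  have hderiv : ∀ t ∈ interior (Ioo 0 T), deriv (fun τ => ∫ x in Ioi (0:ℝ), x * ω τ x) t = 0 := by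
    rw [interior_Ioo]
    intro t ht
    rw [(hD t ht).deriv, zero_mul]
  have hcont : ContinuousOn (fun τ => ∫ x in Ioi (0:ℝ), x * ω τ x) (Ioo 0 T) :=
    fun t ht => (hD t ht).continuousAt.continuousWithinAt
  have hdiff : DifferentiableOn ℝ (fun τ => ∫ x in Ioi (0:ℝ), x * ω τ x) (interior (Ioo 0 T)) := by
    rw [interior_Ioo]
    exact fun t ht => (hD t ht).differentiableAt.differentiableWithinAt
  have hmono := monotoneOn_of_deriv_nonneg (convex_Ioo 0 T) hcont hdiff (fun t ht => (hderiv t ht).symm.le)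
  have hanti := antitoneOn_of_deriv_nonpos (convex_Ioo 0 T) hcont hdiff (fun t ht => (hderiv t ht).le)
  intro s hs t ht
  rcases le_total s t with hst | hts
  · exact le_antisymm (hmono hs ht hst) (hanti hs ht hst)
  · exact le_antisymm (hanti ht hs hts) (hmono ht hs hts)

end MomentLaw

end SheetHalfLine
end Summit.NavierStokesRegularity.OSWSelfSimilar
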